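import Literature.AlgebraicGeometry.Hu2025.Statements.S03Pluecker.R101bPrimary
import HarnessLib

/-!
# Hu 2025 §3.3 Proposition 3.6 — DISCHARGE AS TYPED, part 1: toolkit and the `3 × 3` minors of `[I₃ | A]` in closed form (row 101b,
# typer res-type-009; the `_holds` theorems are in `Prop36.lean`)

**HONEST FRAMING (D-0012/D-0089).** A kernel proof of a typed statement is a theorem about THAT statement: the two sentences of Prop 3.6
(chunk p0018 l.75–88) were typed over the RING-LEVEL READING of «𝕌 ∩ Gr^{3,E}» (`chartParam` = evaluation on the universal point `[I₃ | A]`,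
module docstring of `R101bPrimary.lean`). What is proved here: (2) `k[Var_𝕌] → k[x_u]/(𝓕_m)` is an isomorphism — the printed proof
p0018 l.96–131 («each F̄_{(123),u} is equivalent to an expression of the leading variable x_u as a polynomial in the free variables of Var_𝕌»,
in two rounds: rank 0, then rank 1) made formal through the retraction `chartParam`; (1) `ker chartParam = (𝓕_m)` — the minors of `[I₃ | A]`
satisfy the primary relations (`⊇`), and `f ≡ chartParam(f)` modulo `(𝓕_m)` for every `f` (`⊆`). So Prop 3.6 AS TYPED FOLLOWS (both
sentences), for every `n` and every commutative base ring `k` — the base case «initial check of an induction» (l.91–92) is kernel-certified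
for OUR reading; whether the reading is the printed meaning is the lanes' call. The preprint stays «under review»; nothing here is progress on
resolution of singularities; AI proof is weaker than expert review.

## Contents (part 1)
§1 toolkit (membership in `𝕀_{3,n}` / `Var`-index sets, `xbar`/`bvar` as variables, basic = `(12a),(13a),(23a)`) · §2 the columns and the
`3 × 3` minors of `[I₃ | A]` in closed form (`chartMinor_12a/13a/23a/1bc/2bc/3bc`, cofactor expansion `chartMinor_abc`). Part 2 (`Prop36.lean`):
§3 `chartParam` kills every `F̄_{m,u}` · §4 `chartParam ∘ basicIncl = id`, `x_u ≡ basicIncl (chartParam x_u) mod (𝓕_m)` · §5 the `_holds`.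
-/

noncomputable section

namespace Literature.AlgebraicGeometry.Hu2025.Statements.S03Pluecker

open MvPolynomial

universe u

variable {n : ℕ} (k : Type u) [CommRing k]

/-! ## §1 Toolkit -/

/-- Membership in `𝕀_{3,n}` unfolded.
[cite: Hu2025, Prop. 3.6, p.38 l.11–19 (unrefereed preprint arXiv:2507.21400v1 under adjudication, D-0012/D-0089
— kernel support on OUR typed carriers of row 101; nothing of the source asserted)] -/
theorem mem_plIndexSet_iff {t : ℕ × ℕ × ℕ} :
    t ∈ plIndexSet n ↔ (1 ≤ t.1 ∧ t.1 ≤ n) ∧ ((1 ≤ t.2.1 ∧ t.2.1 ≤ n) ∧ (1 ≤ t.2.2 ∧ t.2.2 ≤ n)) ∧ t.1 < t.2.1 ∧ t.2.1 < t.2.2 := by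
  unfold plIndexSet
  simp only [Finset.mem_filter, Finset.mem_product, Finset.mem_Icc]
  constructor
  · rintro ⟨⟨h1, h2, h3⟩, h4, h5⟩; exact ⟨h1, ⟨h2, h3⟩, h4, h5⟩
  · rintro ⟨h1, ⟨h2, h3⟩, h4, h5⟩; exact ⟨⟨h1, h2, h3⟩, h4, h5⟩

/-- An increasing triple in `[n]` lies in `𝕀_{3,n}`.
[cite: Hu2025, Prop. 3.6, p.38 l.11–19 (unrefereed preprint arXiv:2507.21400v1 under adjudication, D-0012/D-0089
— kernel support on OUR typed carriers of row 101; nothing of the source asserted)] -/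
theorem mem_plIndexSet {a b c : ℕ} (ha : 1 ≤ a) (hab : a < b) (hbc : b < c) (hc : c ≤ n) : (a, b, c) ∈ plIndexSet n := by
  rw [mem_plIndexSet_iff]; simp only; omega

/-- … and in the variable index set when it is not `(1,2,3)`.
[cite: Hu2025, Prop. 3.6, p.38 l.11–19 (unrefereed preprint arXiv:2507.21400v1 under adjudication, D-0012/D-0089
— kernel support on OUR typed carriers of row 101; nothing of the source asserted)] -/
theorem mem_plVarSet {a b c : ℕ} (ha : 1 ≤ a) (hab : a < b) (hbc : b < c) (hc : c ≤ n) (h3 : 3 < c) : (a, b, c) ∈ plVarSet n := by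
  unfold plVarSet
  rw [Finset.mem_erase]
  refine ⟨?_, mem_plIndexSet ha hab hbc hc⟩
  unfold mTri
  intro h
  simp only [Prod.mk.injEq] at h
  omega

/-- `x̄_t` is the variable `x_t` for `t ∈ 𝕀_{3,n} ∖ m`.
[cite: Hu2025, Prop. 3.6, p.38 l.11–19 (unrefereed preprint arXiv:2507.21400v1 under adjudication, D-0012/D-0089
— kernel support on OUR typed carriers of row 101; nothing of the source asserted)] -/
theorem xbar_of_mem {t : ℕ × ℕ × ℕ} (h : t ∈ plVarSet n) : (xbar k t : ChartRing n k) = X ⟨t, h⟩ := by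
  have hm : t ≠ mTri := (Finset.mem_erase.mp h).1
  unfold xbar
  rw [if_neg hm, dif_pos h]

/-- `x̄_m = 1`.
[cite: Hu2025, Prop. 3.6, p.38 l.11–19 (unrefereed preprint arXiv:2507.21400v1 under adjudication, D-0012/D-0089
— kernel support on OUR typed carriers of row 101; nothing of the source asserted)] -/
theorem xbar_mTri : (xbar k mTri : ChartRing n k) = 1 := by
  unfold xbar; rw [if_pos rfl]

/-- The basic variable `x_t ∈ k[Var_𝕌]` as a variable.
[cite: Hu2025, Prop. 3.6, p.38 l.11–19 (unrefereed preprint arXiv:2507.21400v1 under adjudication, D-0012/D-0089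
— kernel support on OUR typed carriers of row 101; nothing of the source asserted)] -/
theorem bvar_of_mem {t : ℕ × ℕ × ℕ} (h : t ∈ plVarSet n) (hb : ¬ IsLt t) :
    (bvar k t : BasicRing n k) = X ⟨⟨t, h⟩, hb⟩ := by
  unfold bvar; rw [dif_pos ⟨h, hb⟩]

/-- `IsLt (a,b,c)` for `3 < b < c`.
[cite: Hu2025, Prop. 3.6, p.38 l.11–19 (unrefereed preprint arXiv:2507.21400v1 under adjudication, D-0012/D-0089
— kernel support on OUR typed carriers of row 101; nothing of the source asserted)] -/
theorem isLt_of_lt {a b c : ℕ} (hb : 3 < b) (hbc : b < c) : IsLt (a, b, c) := by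
  unfold IsLt triSet mSet
  simp only
  have hsub : ({b, c} : Finset ℕ) ⊆ ({a, b, c} : Finset ℕ) \ {1, 2, 3} := by
    intro x hx
    simp only [Finset.mem_insert, Finset.mem_singleton] at hx
    simp only [Finset.mem_sdiff, Finset.mem_insert, Finset.mem_singleton, not_or]
    omega
  have hbc' : ({b, c} : Finset ℕ).card = 2 := by
    rw [Finset.card_insert_of_notMem (by simp; omega), Finset.card_singleton]
  have hle := Finset.card_le_card hsub
  rw [hbc'] at hle
  exact hle

/-- `¬ IsLt (a,b,c)` for `b ≤ 3`.
[cite: Hu2025, Prop. 3.6, p.38 l.11–19 (unrefereed preprint arXiv:2507.21400v1 under adjudication, D-0012/D-0089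
— kernel support on OUR typed carriers of row 101; nothing of the source asserted)] -/
theorem not_isLt_of_le {a b c : ℕ} (ha : 1 ≤ a) (hab : a < b) (hb : b ≤ 3) : ¬ IsLt (a, b, c) := by
  unfold IsLt triSet mSet
  simp only [not_le]
  have hsub : (({a, b, c} : Finset ℕ) \ {1, 2, 3}) ⊆ {c} := by
    intro x hx
    simp only [Finset.mem_sdiff, Finset.mem_insert, Finset.mem_singleton, not_or] at hx
    simp only [Finset.mem_singleton]
    omega
  exact lt_of_le_of_lt ((Finset.card_le_card hsub).trans (Finset.card_singleton c).le) one_lt_two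

/-- `basicIncl` of a basic variable is the chart variable.
[cite: Hu2025, Prop. 3.6, p.38 l.11–19 (unrefereed preprint arXiv:2507.21400v1 under adjudication, D-0012/D-0089
— kernel support on OUR typed carriers of row 101; nothing of the source asserted)] -/
theorem basicIncl_bvar {t : ℕ × ℕ × ℕ} (h : t ∈ plVarSet n) (hb : ¬ IsLt t) :
    basicIncl n k (bvar k t) = xbar k t := by
  rw [bvar_of_mem k h hb, xbar_of_mem k h]
  unfold basicIncl
  rw [rename_X]

/-- `chartParam` on a chart variable is its minor.
[cite: Hu2025, Prop. 3.6, p.38 l.11–19 (unrefereed preprint arXiv:2507.21400v1 under adjudication, D-0012/D-0089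
— kernel support on OUR typed carriers of row 101; nothing of the source asserted)] -/
theorem chartParam_xbar {t : ℕ × ℕ × ℕ} (h : t ∈ plVarSet n) : chartParam n k (xbar k t) = chartMinor k t := by
  rw [xbar_of_mem k h]
  unfold chartParam
  rw [aeval_X]

/-- `chartParam x̄_m = 1`.
[cite: Hu2025, Prop. 3.6, p.38 l.11–19 (unrefereed preprint arXiv:2507.21400v1 under adjudication, D-0012/D-0089
— kernel support on OUR typed carriers of row 101; nothing of the source asserted)] -/
theorem chartParam_xbar_mTri : chartParam n k (xbar k mTri) = 1 := by
  rw [xbar_mTri, map_one]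

/-! ## §2 Columns and minors of `[I₃ | A]` in closed form -/

section Minors

variable {a b c : ℕ}

/-- Column `a > 3` of `[I₃ | A]`.
[cite: Hu2025, Prop. 3.6, p.38 l.11–19 (unrefereed preprint arXiv:2507.21400v1 under adjudication, D-0012/D-0089
— kernel support on OUR typed carriers of row 101; nothing of the source asserted)] -/
theorem chartCol_of_lt (ha : 3 < a) :
    (chartCol k a : Fin 3 → BasicRing n k) = ![bvar k (2, 3, a), -bvar k (1, 3, a), bvar k (1, 2, a)] := by
  unfold chartCol
  rw [if_neg (by omega), if_neg (by omega), if_neg (by omega)]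

/-- Column `1`.
[cite: Hu2025, Prop. 3.6, p.38 l.11–19 (unrefereed preprint arXiv:2507.21400v1 under adjudication, D-0012/D-0089
— kernel support on OUR typed carriers of row 101; nothing of the source asserted)] -/
theorem chartCol_one : (chartCol k 1 : Fin 3 → BasicRing n k) = ![1, 0, 0] := by
  unfold chartCol; rw [if_pos rfl]

/-- Column `2`.
[cite: Hu2025, Prop. 3.6, p.38 l.11–19 (unrefereed preprint arXiv:2507.21400v1 under adjudication, D-0012/D-0089
— kernel support on OUR typed carriers of row 101; nothing of the source asserted)] -/
theorem chartCol_two : (chartCol k 2 : Fin 3 → BasicRing n k) = ![0, 1, 0] := by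
  unfold chartCol; rw [if_neg (by decide), if_pos rfl]

/-- Column `3`.
[cite: Hu2025, Prop. 3.6, p.38 l.11–19 (unrefereed preprint arXiv:2507.21400v1 under adjudication, D-0012/D-0089
— kernel support on OUR typed carriers of row 101; nothing of the source asserted)] -/
theorem chartCol_three : (chartCol k 3 : Fin 3 → BasicRing n k) = ![0, 0, 1] := by
  unfold chartCol; rw [if_neg (by decide), if_neg (by decide), if_pos rfl]

/-- `det([I₃|A] cols 1,2,a) = x_{12a}`.
[cite: Hu2025, Prop. 3.6, p.38 l.11–19 (unrefereed preprint arXiv:2507.21400v1 under adjudication, D-0012/D-0089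
— kernel support on OUR typed carriers of row 101; nothing of the source asserted)] -/
theorem chartMinor_12a (ha : 3 < a) : (chartMinor k (1, 2, a) : BasicRing n k) = bvar k (1, 2, a) := by
  unfold chartMinor
  simp only
  rw [chartCol_one, chartCol_two, chartCol_of_lt k ha, Matrix.det_fin_three]
  simp [Matrix.of_apply]

/-- `det([I₃|A] cols 1,3,a) = x_{13a}`.
[cite: Hu2025, Prop. 3.6, p.38 l.11–19 (unrefereed preprint arXiv:2507.21400v1 under adjudication, D-0012/D-0089
— kernel support on OUR typed carriers of row 101; nothing of the source asserted)] -/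
theorem chartMinor_13a (ha : 3 < a) : (chartMinor k (1, 3, a) : BasicRing n k) = bvar k (1, 3, a) := by
  unfold chartMinor
  simp only
  rw [chartCol_one, chartCol_three, chartCol_of_lt k ha, Matrix.det_fin_three]
  simp [Matrix.of_apply]

/-- `det([I₃|A] cols 2,3,a) = x_{23a}`.
[cite: Hu2025, Prop. 3.6, p.38 l.11–19 (unrefereed preprint arXiv:2507.21400v1 under adjudication, D-0012/D-0089
— kernel support on OUR typed carriers of row 101; nothing of the source asserted)] -/
theorem chartMinor_23a (ha : 3 < a) : (chartMinor k (2, 3, a) : BasicRing n k) = bvar k (2, 3, a) := by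
  unfold chartMinor
  simp only
  rw [chartCol_two, chartCol_three, chartCol_of_lt k ha, Matrix.det_fin_three]
  simp [Matrix.of_apply]

/-- `det([I₃|A] cols 1,b,c) = x_{12b}x_{13c} − x_{13b}x_{12c}` (`b, c > 3`).
[cite: Hu2025, Prop. 3.6, p.38 l.11–19 (unrefereed preprint arXiv:2507.21400v1 under adjudication, D-0012/D-0089
— kernel support on OUR typed carriers of row 101; nothing of the source asserted)] -/
theorem chartMinor_1bc (hb : 3 < b) (hc : 3 < c) :
    (chartMinor k (1, b, c) : BasicRing n k) = bvar k (1, 2, b) * bvar k (1, 3, c) - bvar k (1, 3, b) * bvar k (1, 2, c) := by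
  unfold chartMinor
  simp only
  rw [chartCol_one, chartCol_of_lt k hb, chartCol_of_lt k hc, Matrix.det_fin_three]
  simp [Matrix.of_apply]
  ring

/-- `det([I₃|A] cols 2,b,c) = x_{12b}x_{23c} − x_{23b}x_{12c}`.
[cite: Hu2025, Prop. 3.6, p.38 l.11–19 (unrefereed preprint arXiv:2507.21400v1 under adjudication, D-0012/D-0089
— kernel support on OUR typed carriers of row 101; nothing of the source asserted)] -/
theorem chartMinor_2bc (hb : 3 < b) (hc : 3 < c) :
    (chartMinor k (2, b, c) : BasicRing n k) = bvar k (1, 2, b) * bvar k (2, 3, c) - bvar k (2, 3, b) * bvar k (1, 2, c) := by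
  unfold chartMinor
  simp only
  rw [chartCol_two, chartCol_of_lt k hb, chartCol_of_lt k hc, Matrix.det_fin_three]
  simp [Matrix.of_apply]
  ring

/-- `det([I₃|A] cols 3,b,c) = x_{13b}x_{23c} − x_{23b}x_{13c}`.
[cite: Hu2025, Prop. 3.6, p.38 l.11–19 (unrefereed preprint arXiv:2507.21400v1 under adjudication, D-0012/D-0089
— kernel support on OUR typed carriers of row 101; nothing of the source asserted)] -/
theorem chartMinor_3bc (hb : 3 < b) (hc : 3 < c) :
    (chartMinor k (3, b, c) : BasicRing n k) = bvar k (1, 3, b) * bvar k (2, 3, c) - bvar k (2, 3, b) * bvar k (1, 3, c) := by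
  unfold chartMinor
  simp only
  rw [chartCol_three, chartCol_of_lt k hb, chartCol_of_lt k hc, Matrix.det_fin_three]
  simp [Matrix.of_apply]
  ring

/-- Cofactor expansion: `det(cols a,b,c) = x_{12a}·det(3,b,c) − x_{13a}·det(2,b,c) + x_{23a}·det(1,b,c)` (`a, b, c > 3`) — the shape of
`F̄_{(123),abc}`.
[cite: Hu2025, Prop. 3.6, p.38 l.11–19 (unrefereed preprint arXiv:2507.21400v1 under adjudication, D-0012/D-0089
— kernel support on OUR typed carriers of row 101; nothing of the source asserted)] -/
theorem chartMinor_abc (ha : 3 < a) (hb : 3 < b) (hc : 3 < c) :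
    (chartMinor k (a, b, c) : BasicRing n k) =
      bvar k (1, 2, a) * chartMinor k (3, b, c) - bvar k (1, 3, a) * chartMinor k (2, b, c) + bvar k (2, 3, a) * chartMinor k (1, b, c) := by
  rw [chartMinor_3bc k hb hc, chartMinor_2bc k hb hc, chartMinor_1bc k hb hc]
  unfold chartMinor
  simp only
  rw [chartCol_of_lt k ha, chartCol_of_lt k hb, chartCol_of_lt k hc, Matrix.det_fin_three]
  simp [Matrix.of_apply]
  ring

end Minors

end Literature.AlgebraicGeometry.Hu2025.Statements.S03Pluecker

end
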